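import Summits.QuantumFields.YangMills.Theses.BalabanFluctuationExport
import HarnessLib

/-!
# Route item `SmallEventMeasurable` of `BalabanFluctuationExport` (line `field_regime_split` on the crux `UVSeamRec`, stmt-QuantumFields-20043)

Support item stmt-QuantumFields-26274 of the draft export route `BalabanFluctuationExport`: for every `δ`, every family lattice
`F.P K`, every depth `k` and every finite set of insertion sites, the event «the `k`-fold Bałaban block average
`Q_k V = Averaging.iter (blockAvg su2Mean) k (ofConfig V)` is `δ`-small (`PlaqSmallOn`) on the level-`k` plaquettes within coarse
distance `2` of an insertion block» is a measurable set of fine configurations `V`.  Proof: `Q_k` is measurable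
(`BlockAveraging.measurable_avgFun` iterated, `ofConfig` is a coordinate map), each `W ↦ dist1 (∂W(pl))` is continuous on the finite
product, and the event is a finite intersection of open sublevel sets.

The proof is the ideator's kernel-checked one (ym-idea-9, `Cruxes/UVSeamRec/Lines/field_regime_split.lean`,
`smallEventMeasurable_holds`), landed under `Theorems/` so that the route item is closed by name.  Bookkeeping only; YM mass gap
NOT proved.
-/

set_option autoImplicit false

namespace Summit.QuantumFields.YangMills.Cruxes.UVSeamRec.ExportGlue

open MeasureTheory
open Literature.MathematicalPhysics.QuantumFieldTheory
open Literature.MathematicalPhysics.QuantumFieldTheory.Balaban1983to89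
open Literature.MathematicalPhysics.QuantumFieldTheory.Balaban1983to89.T4Continuum
open Literature.MathematicalPhysics.QuantumLattice (LGConfig torusLift fundamentalLatticeRep)
open Summit.QuantumFields.YangMills.Cruxes.OSLegsFromFemtoAndGap.DlrCollarTransfer (plane)
open Summit.QuantumFields.YangMills.Cruxes.UV.TorusClass (torusEOn)
open Summit.QuantumFields.YangMills.Theses.BalabanFluctuationExport

/-- **Route item `SmallEventMeasurable` (stmt-QuantumFields-26274)**: the δ-small block-field event near finitely many insertion
blocks, pulled back along the `k`-fold Bałaban block average, is measurable. -/
theorem smallEventMeasurable_proof : SmallEventMeasurable := by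
  letI : MeasurableSpace (Matrix.specialUnitaryGroup (Fin 2) ℂ) := borel _
  haveI : BorelSpace (Matrix.specialUnitaryGroup (Fin 2) ℂ) := ⟨rfl⟩
  intro δ F K k hk Q n x cs
  have hav : ∀ j, Measurable (fun U : GaugeField (F.P K) j (Matrix.specialUnitaryGroup (Fin 2) ℂ) =>
      (BlockAveraging.blockAvg (P := F.P K) (j := j) su2Mean).avg U) :=
    fun j => BlockAveraging.measurable_avgFun (P := F.P K) (j := j) su2Mean measurable_su2Mean_E
  have hiter : ∀ k', Measurable (Averaging.iter (P := F.P K) (G := Matrix.specialUnitaryGroup (Fin 2) ℂ)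
      (fun j => BlockAveraging.blockAvg (P := F.P K) (j := j) su2Mean) k') := by
    intro k'
    induction k' with
    | zero => exact measurable_id
    | succ k' ih => exact (hav k').comp ih
  have hof : Measurable (fun V : GaugeConfig 4 ((F.P K).sitesPerDir 0) (Matrix.specialUnitaryGroup (Fin 2) ℂ) =>
      ofConfig (P := F.P K) (j := 0) V) :=
    measurable_pi_lambda _ fun b => measurable_pi_apply _
  have hQ : Measurable Q := (hiter k).comp hof
  have hpl : ∀ pl : Plaq (F.P K) k, Measurable (fun W : GaugeField (F.P K) k (Matrix.specialUnitaryGroup (Fin 2) ℂ) =>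
      dist1 (GaugeField.plaqHol W pl)) := fun pl => by
    have hb : ∀ b : PBond (F.P K) k, Continuous fun U : (PBond (F.P K) k → Matrix.specialUnitaryGroup (Fin 2) ℂ) => U b :=
      fun b => continuous_apply b
    have hc : Continuous fun U : (PBond (F.P K) k → Matrix.specialUnitaryGroup (Fin 2) ℂ) =>
        GaugeField.plaqHol (P := F.P K) (j := k) U pl := by
      unfold GaugeField.plaqHol
      exact (((hb _).mul (hb _)).mul (hb _).inv).mul (hb _).inv
    have hm : Measurable fun U : (PBond (F.P K) k → Matrix.specialUnitaryGroup (Fin 2) ℂ) =>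
        dist1 (GaugeField.plaqHol (P := F.P K) (j := k) U pl) :=
      RegularGaugeGroup.measurable_dist1.comp hc.measurable
    exact hm
  have hS : MeasurableSet {W : GaugeField (F.P K) k (Matrix.specialUnitaryGroup (Fin 2) ℂ) |
      PlaqSmallOn {pl : Plaq (F.P K) k | ∃ i, Site.tdist pl.src (cs i) ≤ 2} δ W} := by
    have : {W : GaugeField (F.P K) k (Matrix.specialUnitaryGroup (Fin 2) ℂ) |
        PlaqSmallOn {pl : Plaq (F.P K) k | ∃ i, Site.tdist pl.src (cs i) ≤ 2} δ W}
        = ⋂ pl ∈ {pl : Plaq (F.P K) k | ∃ i, Site.tdist pl.src (cs i) ≤ 2},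
            {W | dist1 (GaugeField.plaqHol W pl) < δ} := by
      ext W; simp only [PlaqSmallOn, Set.mem_setOf_eq, Set.mem_iInter]
    rw [this]
    exact MeasurableSet.biInter (Set.to_countable _) fun pl _ => measurableSet_lt (hpl pl) measurable_const
  exact hQ hS

end Summit.QuantumFields.YangMills.Cruxes.UVSeamRec.ExportGlue
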